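import Summits.QuantumFields.BalabanUV.T4Continuum.Spine.NE2.ComposedRemainderLipschitz
import Summits.QuantumFields.BalabanUV.T4Continuum.Spine.NE2.OneStepProlongationDefect
import Summits.QuantumFields.BalabanUV.T4Continuum.Spine.NE2.ComposedFullAveragingRate

/-!
# T⁴ programme, spine node NE2 (U1a) — R14 W3a, file 4: THE SANDWICHED TWO-LEVEL FIELDS OF THE CONSTRUCTED REMAINDER `E″` FROM ONE-STEP LETTERS, AND THE (3.26)-SHAPE END WITH
# THE FULL LINEARISED COMPOSED AVERAGING WHOSE ONLY REMAINDER HYPOTHESES ARE LETTERS (cell `pub-balaban-gaps`, seat ne2 gen 5; plan `ne/NE2-R14-PLAN.md` STATUS v5 ADDENDUM)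

Gen 5's `ComposedFullAveragingRate.composed_full_averaging_rate` displays the two sandwiched two-level fields `hRem₂`/`hRem₃` of the constructed remainder `Erem`.  THIS FILE derives them:
 * `opNorm_inv_kron_mul_conjTranspose_eq`: `‖(Δ_{a,k}⊗1)⁻¹Zᴴ‖ = ‖Z(Δ_{a,k}⊗1)⁻¹‖` (`𝒢 = Δ_a⁻¹` is Hermitian, [B5] p. 31), so ONE right-sandwiched bound gives both fields (`‖(Δ⊗1)⁻¹‖ ≤ Cst` reused from `NE2ColourPerturbedLayer`);
 * **`same_data_pair_le`** (King's mechanism, via `Erem_succ` + `OneStepProlongationDefect.opNorm_prolongation_defect_kron_le` + the one-step letters of the TOP step):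
   `‖(E″(W,C)_{k+1}(J_k⊗1) − E″(W,C)_k)(Δ_{a,k}⊗1)⁻¹‖ ≤ r·(d·Cst/n_k + card o·σ_k·Cst) + (1 + card o·τ + r)·c_R·γ_k·Cst`;
 * **`cross_pair_le`** (`ComposedRemainderLipschitz`): `‖(E″(W′,C′)_k − E″(W,C)_k)(Δ_{a,k}⊗1)⁻¹‖ ≤ (F·(Σ_{i<k}Δ_i)·Π_{i<k}(1+ε′_i) + card o·θ_k)·Cst`;
 * **`averagingLaws_Erem`**: the full `AveragingLaws` datum of `k ↦ E″(W^{(k)},C^{(k)})_k` from its size `r`, a same-data bound `s_k`, a cross bound `c_k` and the rate inequality `s_k + c_k ≤ C_r ρ^k`;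
 * **`composed_full_averaging_rate_of_letters`**: gen 4's END with print's composed averaging + (124)'s remainders, E″ CONSTRUCTED, and ALL THREE fields of `hRem` supplied — the remainder
   hypotheses are now LETTERS ONLY: sizes (`σ`, `γ`, `Γ`, `E`), top-step letters (`σ_k^{top}`, `γ_k^{top}`), cross-problem letters (through the bounds `D_k`, `θ_k` of `ComposedRemainderLipschitz`),
   and one real inequality tying them to `C_r ρ^k`.
What is STILL displayed about the remainder: nothing operator-valued; the real inequality `hrate` (in print: `σ_k^{top} = O(αL^{−k})`, `γ_k^{top} = O(L²α₀L^{−2k})`, `D_k, θ_k = O(θ_c^k)`, `n_k⁻¹ = L^{−k} ≤ ρ^k`).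
HONEST FRAMING (T4-DAG p. 1).  MODEL LEVEL; `R`, `W`, `C`, `P₄` and every letter are DISPLAYED hypotheses asserted by nobody; node NE3's `LocalRate` consumed BY NAME (OPEN); NOT NE2, NOT [B9]
(3.16)/(3.26) or [B7] (124)/(143) as printed; **NE2 (U1a) NOT PROVED**; spine PROVED 0/9 unchanged; NOT continuum YM / infinite volume / mass gap / Clay.  HONEST DEPENDENCY: continuum YM on T⁴ ⇐
BetaPertH ∧ nine spine estimates (0/9 proved); BetaPertH ⇐ (D1) ∧ (D4) ∧ CAP+tail; G-an2-4 gates asym, D1 and NE2/3/4.  No `sorry`.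
-/

noncomputable section

open scoped BigOperators ComplexConjugate Matrix Matrix.Norms.L2Operator Kronecker
open Finset (range)

namespace Summit.QuantumFields.BalabanUV.T4Continuum.NE2.ComposedRemainderTwoLevel

open Literature.MathematicalPhysics.QuantumFieldTheory.Balaban1983to89.B5Prop11Plancherel (Tor fine Cst Cst_nonneg calG_isHermitian)
open Literature.MathematicalPhysics.QuantumFieldTheory.Balaban1983to89.B5G183RateUnitTower (lev lev_neZero)
open Literature.MathematicalPhysics.QuantumFieldTheory.Balaban1983to89.T4EtaRateMin (LocalRate)
open Summit.QuantumFields.BalabanUV.T4Continuum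
open Summit.QuantumFields.BalabanUV.T4Continuum.BalabanAveragedTowerUnit (idx Qlev calGlev cast_lev')
open Summit.QuantumFields.BalabanUV.T4Continuum.KingPairingPlantedLaw (JK JpcT JpcT_eq_JK calDalev calDalev_inv opNorm_JpcT_le opNorm_inv_calDalev_le CJ)
open Summit.QuantumFields.BalabanUV.T4Continuum.GramPerturbationLaw (AveragingLaws C2gram)
open Summit.QuantumFields.BalabanUV.T4Continuum.CovariantAveragingTower (TowerLimitRate)
open Summit.QuantumFields.BalabanUV.T4Continuum.BackgroundResolventTower (PerturbationLaws Cpert)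
open Summit.QuantumFields.BalabanUV.T4Continuum.RegularBackgroundTower (RegularTransporters regClass)
open Summit.QuantumFields.BalabanUV.T4Continuum.NE2FromNE3 (bgReadings)
open Summit.QuantumFields.BalabanUV.T4Continuum.CovariantAveragingSummand (kappaQ)
open Summit.QuantumFields.BalabanUV.T4Continuum.NE2BalabanLayer (tierBPert kappaB C2B)
open Summit.QuantumFields.BalabanUV.T4Continuum.NE2ColourPerturbedLayer (opNorm_inv_calDalev_kron_le)
open Summit.QuantumFields.BalabanUV.T4Continuum.KroneckerLift (kron_mul kron_inv kron_conjTranspose opNorm_kron_le_of_le)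
open Summit.QuantumFields.BalabanUV.T4Continuum.CovariantBlockAveraging (sqrtVol Bfree opNorm_Bfree_le)
open Summit.QuantumFields.BalabanUV.T4Continuum.CovariantVectorChartModulus (norm_transport_le_one)
open Summit.QuantumFields.BalabanUV.T4Continuum.NE2.CovariantTableTower (EcovT opNorm_EcovT_le)
open Summit.QuantumFields.BalabanUV.T4Continuum.NE2.CovariantTableBalaban (TBal)
open Summit.QuantumFields.BalabanUV.T4Continuum.NE2.ComposedAveragingMean (thetaZero)
open Summit.QuantumFields.BalabanUV.T4Continuum.NE2.ComposedAveragingRate (norm_TBal_sub_one_le_exp)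
open Summit.QuantumFields.BalabanUV.T4Continuum.NE2.ComposedAveragingRemainder (avgPertFull composed_averaging_remainder_rate)
open Summit.QuantumFields.BalabanUV.T4Continuum.NE2.ComposedAveragingIdentity (Qstep)
open Summit.QuantumFields.BalabanUV.T4Continuum.NE2.OneStepRemainder (Smain opNorm_Qrem_le)
open Summit.QuantumFields.BalabanUV.T4Continuum.NE2.ComposedRemainderTower (RemCoeff QremStep QmainStep QlinStep QfullLev Erem Erem_succ Bfree_add_EcovT_add_Erem cR cR_nonneg opNorm_Erem_le)
open Summit.QuantumFields.BalabanUV.T4Continuum.NE2.OneStepRemainderLipschitz (opNorm_Qstep_sub_Qstep_le)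
open Summit.QuantumFields.BalabanUV.T4Continuum.NE2.OneStepProlongationDefect (opNorm_prolongation_defect_kron_le)

variable {d : ℕ} (L : ℕ) [NeZero L] (M : Fin d → ℕ) [hM : ∀ μ, NeZero (M μ)] {o : Type*} [Fintype o] [DecidableEq o] (a : ℝ) (ha : 0 < a)

/-! ## §1 The Hermitian sandwich -/

/-- `‖(Δ_{a,k}⊗1)⁻¹·Zᴴ‖ = ‖Z·(Δ_{a,k}⊗1)⁻¹‖` — `𝒢 = Δ_a⁻¹` is Hermitian. [cite: Balaban1984PropagatorsI, p.31 «G is a symmetric operator»] [folklore] -/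
theorem opNorm_inv_kron_mul_conjTranspose_eq (k : ℕ) (Z : Matrix ((Tor M × Fin d) × o) (idx L M k × o) ℂ) :
    ‖(calDalev L M a ha k ⊗ₖ (1 : Matrix o o ℂ))⁻¹ * Zᴴ‖ = ‖Z * (calDalev L M a ha k ⊗ₖ (1 : Matrix o o ℂ))⁻¹‖ := by
  have hH : ((calDalev L M a ha k ⊗ₖ (1 : Matrix o o ℂ))⁻¹)ᴴ = (calDalev L M a ha k ⊗ₖ (1 : Matrix o o ℂ))⁻¹ := by
    rw [kron_inv, kron_conjTranspose, calDalev_inv, calGlev, (calG_isHermitian (lev L k) _ M a ha).eq]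
  calc ‖(calDalev L M a ha k ⊗ₖ (1 : Matrix o o ℂ))⁻¹ * Zᴴ‖ = ‖(Z * (calDalev L M a ha k ⊗ₖ (1 : Matrix o o ℂ))⁻¹)ᴴ‖ := by
        rw [Matrix.conjTranspose_mul, hH]
    _ = ‖Z * (calDalev L M a ha k ⊗ₖ (1 : Matrix o o ℂ))⁻¹‖ := Matrix.l2_opNorm_conjTranspose _

-- `‖(Δ_{a,k}⊗1)⁻¹‖ ≤ Cst` is the tree's `NE2ColourPerturbedLayer.opNorm_inv_calDalev_kron_le` (reused; dedup dry-run).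

/-- **PACKAGING**: size + a right-sandwiched same-data bound + a right-sandwiched cross bound at rate `C_r ρ^k` give the full `AveragingLaws` datum. [folklore] -/
theorem averagingLaws_of_right_bounds {X : (k : ℕ) → Matrix ((Tor M × Fin d) × o) (idx L M k × o) ℂ} {Y : (k : ℕ) → Matrix ((Tor M × Fin d) × o) (idx L M k × o) ℂ}
    {r Cr ρ : ℝ} {s c : ℕ → ℝ} (hop : ∀ k, ‖X k‖ ≤ r)
    (hsame : ∀ k, ‖(X (k + 1) * (JpcT L M k ⊗ₖ (1 : Matrix o o ℂ)) - Y k) * (calDalev L M a ha k ⊗ₖ (1 : Matrix o o ℂ))⁻¹‖ ≤ s k)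
    (hcross : ∀ k, ‖(Y k - X k) * (calDalev L M a ha k ⊗ₖ (1 : Matrix o o ℂ))⁻¹‖ ≤ c k) (hrate : ∀ k, s k + c k ≤ Cr * ρ ^ k) :
    AveragingLaws (fun k => calDalev L M a ha k ⊗ₖ (1 : Matrix o o ℂ)) X (fun k => JpcT L M k ⊗ₖ (1 : Matrix o o ℂ)) r (fun k => Cr * ρ ^ k) := by
  have hright : ∀ k, ‖(X (k + 1) * (JpcT L M k ⊗ₖ (1 : Matrix o o ℂ)) - X k) * (calDalev L M a ha k ⊗ₖ (1 : Matrix o o ℂ))⁻¹‖ ≤ Cr * ρ ^ k := by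
    intro k
    have e : (X (k + 1) * (JpcT L M k ⊗ₖ (1 : Matrix o o ℂ)) - X k) * (calDalev L M a ha k ⊗ₖ (1 : Matrix o o ℂ))⁻¹
        = (X (k + 1) * (JpcT L M k ⊗ₖ (1 : Matrix o o ℂ)) - Y k) * (calDalev L M a ha k ⊗ₖ (1 : Matrix o o ℂ))⁻¹
          + (Y k - X k) * (calDalev L M a ha k ⊗ₖ (1 : Matrix o o ℂ))⁻¹ := by
      rw [← Matrix.add_mul, sub_add_sub_cancel]
    rw [e]
    exact (norm_add_le _ _).trans ((add_le_add (hsame k) (hcross k)).trans (hrate k))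
  exact ⟨hop, hright, fun k => by rw [opNorm_inv_kron_mul_conjTranspose_eq]; exact hright k⟩

/-! ## §2 The same-data two-level defect (King's mechanism) -/

section Same

variable [Nonempty o]

/-- **THE SAME-DATA TWO-LEVEL DEFECT OF THE COMPOSED REMAINDER**: for ONE data tower `(W, C)`,
`‖(E″_{k+1}(J_k⊗1) − E″_k)(Δ_{a,k}⊗1)⁻¹‖ ≤ ‖E″_k‖·(d·Cst/n_k + card o·σ_k·Cst) + ‖B_k + E_k + E″_k‖·c_R·γ_k·Cst`, with `σ_k`, `γ_k` the one-step letters of the step `k → k+1`.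
[cite: Balaban1985Averaging, (143) p.39 (shape); King1986, Lemma 4.5 p.674 (method)] [folklore] -/
theorem same_data_pair_le {W : (i : ℕ) → Fin d → (idx L M i → Matrix o o ℂ)} {C : RemCoeff d L M o} {σk γk : ℝ} (hσk : 0 ≤ σk) (hγk : 0 ≤ γk) (k : ℕ)
    (hWn : ∀ ν b, ‖W (k + 1) ν b‖ ≤ 1) (hS : ∀ x r μ (s : Fin L), ‖(haveI := lev_neZero L k; Smain (lev L k) L M (W (k + 1)) x r μ s) - 1‖ ≤ σk)
    (hG₁ : ∀ x μ r, ‖C.G₁ k x μ r‖ ≤ γk) (hG₂ : ∀ x μ r, ‖C.G₂ k x μ r‖ ≤ γk) (hG₃ : ∀ x μ, ‖C.G₃ k x μ‖ ≤ γk) (hRc : ∀ x μ, ‖C.Rc k x μ‖ ≤ 1) :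
    ‖(Erem L M W C (k + 1) * (JpcT L M k ⊗ₖ (1 : Matrix o o ℂ)) - Erem L M W C k) * (calDalev L M a ha k ⊗ₖ (1 : Matrix o o ℂ))⁻¹‖
      ≤ ‖Erem L M W C k‖ * (d * Cst d a / (lev L k : ℕ) + Fintype.card o * σk * Cst d a)
        + ‖Bfree L M k + EcovT L M (fun k => TBal L M W k) k + Erem L M W C k‖ * (cR d L o * γk) * Cst d a := by
  haveI := lev_neZero L k
  have hCst := Cst_nonneg d a
  have hsL : (0 : ℝ) < Real.sqrt ((L : ℝ) ^ d) := Real.sqrt_pos.mpr (pow_pos (by exact_mod_cast Nat.pos_of_ne_zero (NeZero.ne L)) d)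
  have hnsL : ‖((Real.sqrt ((L : ℝ) ^ d) : ℝ) : ℂ)‖ = Real.sqrt ((L : ℝ) ^ d) := by rw [Complex.norm_real, Real.norm_of_nonneg hsL.le]
  set sL : ℂ := ((Real.sqrt ((L : ℝ) ^ d) : ℝ) : ℂ) with hsLdef
  set J := JpcT L M k ⊗ₖ (1 : Matrix o o ℂ) with hJ
  set G := (calDalev L M a ha k ⊗ₖ (1 : Matrix o o ℂ))⁻¹ with hG
  set E := Erem L M W C k with hE
  set S := Bfree L M k + EcovT L M (fun k => TBal L M W k) k + Erem L M W C k with hS'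
  set Qm := QmainStep L M W k with hQm
  set Q1 : Matrix (idx L M k × o) (idx L M (k + 1) × o) ℂ := Qstep (lev L k) L M (fun _ _ _ _ => (1 : Matrix o o ℂ)) with hQ1
  set Qr := QremStep L M W C k with hQr
  have hJn : ‖J‖ ≤ 1 := opNorm_kron_le_of_le o (opNorm_JpcT_le L M k)
  have hGn : ‖G‖ ≤ Cst d a := opNorm_inv_calDalev_kron_le L M a ha k
  -- the algebra: `(√L^d(E·Qm + S·Qr))J − E = E(√L^d·QmJ − 1) + √L^d·S·Qr·J`, and `Qm = Q1 + (Qm − Q1)`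
  have e : (Erem L M W C (k + 1) * J - E) * G
      = E * ((sL • (Q1 * J) - 1) * G) + E * (sL • ((Qm - Q1) * J * G)) + sL • (S * Qr * J * G) := by
    rw [Erem_succ, ← hsLdef, ← hS', ← hE, ← hQm, ← hQr]
    simp only [Matrix.smul_mul, Matrix.add_mul, Matrix.mul_sub, Matrix.mul_smul, Matrix.one_mul, Matrix.sub_mul, Matrix.mul_assoc, smul_sub, smul_add]
    abel
  rw [e]
  -- the three pieces
  have h1 : ‖E * ((sL • (Q1 * J) - 1) * G)‖ ≤ ‖E‖ * (d * Cst d a / (lev L k : ℕ)) := by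
    refine (Matrix.l2_opNorm_mul _ _).trans (mul_le_mul_of_nonneg_left ?_ (norm_nonneg _))
    have h := opNorm_prolongation_defect_kron_le L M a ha (o := o) k
    have e1 : (sL • (Q1 * J) - 1) * G
        = (sL • (Qstep (lev L k) L M (fun _ _ _ _ => (1 : Matrix o o ℂ)) * (JK (lev L k) L M ⊗ₖ (1 : Matrix o o ℂ))) - 1) * ((calDalev L M a ha k)⁻¹ ⊗ₖ (1 : Matrix o o ℂ)) := by
      rw [hQ1, hJ, hG, kron_inv]; rfl
    rw [e1]; exact h
  have h2 : ‖E * (sL • ((Qm - Q1) * J * G))‖ ≤ ‖E‖ * (Fintype.card o * σk * Cst d a) := by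
    refine (Matrix.l2_opNorm_mul _ _).trans (mul_le_mul_of_nonneg_left ?_ (norm_nonneg _))
    rw [norm_smul, hnsL]
    have hX1 : 0 ≤ Fintype.card o * σk * (Real.sqrt ((L : ℝ) ^ d))⁻¹ := mul_nonneg (mul_nonneg (Nat.cast_nonneg _) hσk) (inv_nonneg.mpr hsL.le)
    have hd : ‖Qm - Q1‖ ≤ Fintype.card o * σk * (Real.sqrt ((L : ℝ) ^ d))⁻¹ := by
      rw [hQm, hQ1, QmainStep]
      exact opNorm_Qstep_sub_Qstep_le (lev L k) L M hσk (S := fun _ _ _ _ => (1 : Matrix o o ℂ)) (S' := Smain (lev L k) L M (W (k + 1))) hS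
    calc Real.sqrt ((L : ℝ) ^ d) * ‖(Qm - Q1) * J * G‖ ≤ Real.sqrt ((L : ℝ) ^ d) * (Fintype.card o * σk * (Real.sqrt ((L : ℝ) ^ d))⁻¹ * 1 * Cst d a) := by
          refine mul_le_mul_of_nonneg_left ?_ hsL.le
          calc ‖(Qm - Q1) * J * G‖ ≤ ‖(Qm - Q1) * J‖ * ‖G‖ := Matrix.l2_opNorm_mul _ _
            _ ≤ ‖Qm - Q1‖ * ‖J‖ * ‖G‖ := mul_le_mul_of_nonneg_right (Matrix.l2_opNorm_mul _ _) (norm_nonneg _)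
            _ ≤ Fintype.card o * σk * (Real.sqrt ((L : ℝ) ^ d))⁻¹ * 1 * Cst d a :=
                mul_le_mul (mul_le_mul hd hJn (norm_nonneg _) hX1) hGn (norm_nonneg _) (mul_nonneg hX1 zero_le_one)
      _ = Fintype.card o * σk * Cst d a := by field_simp
  have h3 : ‖sL • (S * Qr * J * G)‖ ≤ ‖S‖ * (cR d L o * γk) * Cst d a := by
    rw [norm_smul, hnsL]
    have hR : ‖Qr‖ ≤ cR d L o * γk * (Real.sqrt ((L : ℝ) ^ d))⁻¹ := by
      refine (opNorm_Qrem_le (lev L k) L M hγk hWn hG₁ hG₂ hG₃ hRc).trans (le_of_eq ?_)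
      rw [cR]; ring
    have hcR := cR_nonneg (d := d) L (o := o)
    have hX3 : 0 ≤ ‖S‖ * (cR d L o * γk * (Real.sqrt ((L : ℝ) ^ d))⁻¹) := mul_nonneg (norm_nonneg _) (mul_nonneg (mul_nonneg hcR hγk) (inv_nonneg.mpr hsL.le))
    calc Real.sqrt ((L : ℝ) ^ d) * ‖S * Qr * J * G‖ ≤ Real.sqrt ((L : ℝ) ^ d) * (‖S‖ * (cR d L o * γk * (Real.sqrt ((L : ℝ) ^ d))⁻¹) * 1 * Cst d a) := by
          refine mul_le_mul_of_nonneg_left ?_ hsL.le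
          calc ‖S * Qr * J * G‖ ≤ ‖S * Qr * J‖ * ‖G‖ := Matrix.l2_opNorm_mul _ _
            _ ≤ ‖S * Qr‖ * ‖J‖ * ‖G‖ := mul_le_mul_of_nonneg_right (Matrix.l2_opNorm_mul _ _) (norm_nonneg _)
            _ ≤ ‖S‖ * ‖Qr‖ * ‖J‖ * ‖G‖ := mul_le_mul_of_nonneg_right (mul_le_mul_of_nonneg_right (Matrix.l2_opNorm_mul _ _) (norm_nonneg _)) (norm_nonneg _)
            _ ≤ ‖S‖ * (cR d L o * γk * (Real.sqrt ((L : ℝ) ^ d))⁻¹) * 1 * Cst d a :=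
                mul_le_mul (mul_le_mul (mul_le_mul_of_nonneg_left hR (norm_nonneg _)) hJn (norm_nonneg _) hX3) hGn (norm_nonneg _) (mul_nonneg hX3 zero_le_one)
      _ = ‖S‖ * (cR d L o * γk) * Cst d a := by field_simp
  calc _ ≤ ‖E * ((sL • (Q1 * J) - 1) * G)‖ + ‖E * (sL • ((Qm - Q1) * J * G))‖ + ‖sL • (S * Qr * J * G)‖ := norm_add₃_le
    _ ≤ ‖E‖ * (d * Cst d a / (lev L k : ℕ)) + ‖E‖ * (Fintype.card o * σk * Cst d a) + ‖S‖ * (cR d L o * γk) * Cst d a := add_le_add (add_le_add h1 h2) h3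
    _ = _ := by ring

end Same

/-! ## §3 The cross-problem defect -/

section Cross

/-- **THE CROSS-PROBLEM DEFECT AT A FIXED LEVEL**: `‖(E″(W′,C′)_k − E″(W,C)_k)(Δ_{a,k}⊗1)⁻¹‖ ≤ (‖D_k‖ + card o·θ_k)·Cst` with `D_k = √(n_k^d)(Q^{full′}_k − Q^{full}_k)` (bounded by
`ComposedRemainderLipschitz.opNorm_sqrtVol_smul_QfullLev_sub_le`) and `θ_k` the entrywise letter on `T_Bal(W′)_k − T_Bal(W)_k`. [folklore] -/
theorem cross_pair_le {W W' : (i : ℕ) → Fin d → (idx L M i → Matrix o o ℂ)} {C C' : RemCoeff d L M o} {θ : ℝ} (hθ : 0 ≤ θ) (k : ℕ)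
    (hT : ∀ y j μ (t : Fin (lev L k)), ‖TBal L M W' k y j μ t - TBal L M W k y j μ t‖ ≤ θ) :
    ‖(Erem L M W' C' k - Erem L M W C k) * (calDalev L M a ha k ⊗ₖ (1 : Matrix o o ℂ))⁻¹‖
      ≤ (‖sqrtVol d L k • (QfullLev L M W' C' k - QfullLev L M W C k)‖ + Fintype.card o * θ) * Cst d a :=
  (Matrix.l2_opNorm_mul _ _).trans (mul_le_mul (ComposedRemainderLipschitz.opNorm_Erem_sub_Erem_le L M (C := C) (C' := C') hθ k hT) (opNorm_inv_calDalev_kron_le L M a ha k)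
    (norm_nonneg _) (add_nonneg (norm_nonneg _) (mul_nonneg (Nat.cast_nonneg _) hθ)))

end Cross

/-! ## §4 The datum and the END -/

section End

variable [Nonempty o]

omit [Nonempty o] in
/-- **THE `AveragingLaws` DATUM OF THE CONSTRUCTED REMAINDER FROM LETTERS**: size `r` (file 3 of W3), same-data bounds `s_k` (§2), cross bounds `c_k` (§3), and `s_k + c_k ≤ C_rρ^k`.
[folklore] -/
theorem averagingLaws_Erem {W : ℕ → (i : ℕ) → Fin d → (idx L M i → Matrix o o ℂ)} {Cf : ℕ → RemCoeff d L M o} {r Cr ρ : ℝ} {s c : ℕ → ℝ}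
    (hop : ∀ k, ‖Erem L M (W k) (Cf k) k‖ ≤ r)
    (hsame : ∀ k, ‖(Erem L M (W (k + 1)) (Cf (k + 1)) (k + 1) * (JpcT L M k ⊗ₖ (1 : Matrix o o ℂ)) - Erem L M (W (k + 1)) (Cf (k + 1)) k)
      * (calDalev L M a ha k ⊗ₖ (1 : Matrix o o ℂ))⁻¹‖ ≤ s k)
    (hcross : ∀ k, ‖(Erem L M (W (k + 1)) (Cf (k + 1)) k - Erem L M (W k) (Cf k) k) * (calDalev L M a ha k ⊗ₖ (1 : Matrix o o ℂ))⁻¹‖ ≤ c k)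
    (hrate : ∀ k, s k + c k ≤ Cr * ρ ^ k) :
    AveragingLaws (fun k => calDalev L M a ha k ⊗ₖ (1 : Matrix o o ℂ)) (fun k => Erem L M (W k) (Cf k) k) (fun k => JpcT L M k ⊗ₖ (1 : Matrix o o ℂ)) r (fun k => Cr * ρ ^ k) :=
  averagingLaws_of_right_bounds L M a ha (Y := fun k => Erem L M (W (k + 1)) (Cf (k + 1)) k) hop hsame hcross hrate

/-- the transport-difference letter of a step: `(1 + c)^{(d+1)L} − 1`. [folklore] -/
def deltaS (d L : ℕ) (c : ℝ) : ℝ := (1 + c) ^ ((d + 1) * L) - 1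

variable (d) (o) in
/-- the size letter of a primed full step: `ε = card o·σ + c_R·γ`. [folklore] -/
def epsStep (σ γ : ℝ) : ℝ := Fintype.card o * σ + cR d L o * γ

variable (d) (o) in
/-- the difference letter of a full step: `Δ = card o·δS + c_R(δG + γ(δR + 2δS))`. [folklore] -/
def DeltaStep (c γ δG δR : ℝ) : ℝ := Fintype.card o * deltaS d L c + cR d L o * (δG + γ * (δR + 2 * deltaS d L c))

variable (d) (o) in
/-- the SAME-DATA bound of `same_data_pair_le` as a function of the letters: `r(d·Cst/n + card o·σ^{top}·Cst) + F·c_R·γ^{top}·Cst`. [folklore] -/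
def sameBnd (Cs r F σt γt : ℝ) (n : ℕ) : ℝ := r * (d * Cs / n + Fintype.card o * σt * Cs) + F * (cR d L o * γt) * Cs

variable (o) in
/-- the CROSS bound of `cross_pair_le` as a function of the letters: `(F·ΣΔ·Π(1+ε) + card o·θ)·Cst`. [folklore] -/
def crossBnd (Cs F Dsum P θk : ℝ) : ℝ := (F * Dsum * P + Fintype.card o * θk) * Cs

/-- **THE (3.26)-SHAPE END WITH THE FULL LINEARISED COMPOSED AVERAGING, THE REMAINDER DATUM SUPPLIED FROM LETTERS**: gen 4's `composed_averaging_remainder_rate` with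
`Erem k := E″(W^{(k)},C^{(k)})_k` CONSTRUCTED and ALL THREE fields of `hRem` PROVED from: the one-step size letters `σ k i`, `γ k i` (sums `Γ`, `E`), the cross-problem letters `cW k i`, `δG k i`,
`δR k i` (data of the problems at levels `k+1` and `k`, NE3-type), the composed-table cross letter `θ k`, and ONE real inequality `hrate` tying the resulting same-data and cross bounds to `C_r ρ^k`.
[cite: Balaban1985BackgroundPropagators, (3.15)–(3.16) p.393, (3.26) p.395; Balaban1985Averaging, (124) p.36, (139)–(143) p.39; King1986, Lemma 4.5 (4.38) p.674 (method)] [folklore] -/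
theorem composed_full_averaging_rate_of_letters (hL : 2 ≤ L) (hd : 1 ≤ d) {R : (k : ℕ) → Fin d → (idx L M k → Matrix o o ℂ)} {αR βR : ℝ}
    (hreg : RegularTransporters L M R αR βR) {C : ℝ} (hC : 0 ≤ C) (hNE3 : LocalRate (bgReadings L M (regClass L M R)) C ((L : ℝ)⁻¹))
    {W : ℕ → (i : ℕ) → Fin d → (idx L M i → Matrix o o ℂ)} {α σ θc ρ : ℝ}
    (hα : 0 ≤ α) (hσ : 0 ≤ σ) (hθ0 : 0 ≤ θc) (hθ1 : θc ≤ 1) (hθρ : θc ≤ ρ) (hρ : 3 / (2 * (L : ℝ)) ≤ ρ) (hρ1 : ρ < 1)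
    (hWn : ∀ k i ν b, ‖W k i ν b‖ ≤ 1) (hWa : ∀ k i ν b, ‖W k i ν b - 1‖ ≤ α / (lev L i : ℕ))
    (hWc : ∀ k i ν b, i ≤ k → ‖W (k + 1) i ν b - W k i ν b‖ ≤ σ * θc ^ k / (lev L i : ℕ))
    {Cf : ℕ → RemCoeff d L M o} {σ₁ γ cW δG δR : ℕ → ℕ → ℝ} {θ : ℕ → ℝ} {Γ E Cr : ℝ}
    (hσ₁0 : ∀ k i, 0 ≤ σ₁ k i) (hγ0 : ∀ k i, 0 ≤ γ k i) (hcW0 : ∀ k i, 0 ≤ cW k i) (hδG0 : ∀ k i, 0 ≤ δG k i) (hδR0 : ∀ k i, 0 ≤ δR k i) (hθ0' : ∀ k, 0 ≤ θ k)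
    (hS : ∀ k i x r μ (s : Fin L), ‖(haveI := lev_neZero L i; Smain (lev L i) L M (W k (i + 1)) x r μ s) - 1‖ ≤ σ₁ k i)
    (hG₁ : ∀ k i x μ r, ‖(Cf k).G₁ i x μ r‖ ≤ γ k i) (hG₂ : ∀ k i x μ r, ‖(Cf k).G₂ i x μ r‖ ≤ γ k i) (hG₃ : ∀ k i x μ, ‖(Cf k).G₃ i x μ‖ ≤ γ k i) (hRc : ∀ k i x μ, ‖(Cf k).Rc i x μ‖ ≤ 1)
    (hΓ : ∀ k k', ∑ i ∈ range k', γ k i ≤ Γ) (hE : ∀ k k', ∑ i ∈ range k', (Fintype.card o * σ₁ k i + cR d L o * γ k i) ≤ E)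
    (hWd : ∀ k i ν b, ‖W (k + 1) (i + 1) ν b - W k (i + 1) ν b‖ ≤ cW k i)
    (hGd₁ : ∀ k i x μ r, ‖(Cf (k + 1)).G₁ i x μ r - (Cf k).G₁ i x μ r‖ ≤ δG k i) (hGd₂ : ∀ k i x μ r, ‖(Cf (k + 1)).G₂ i x μ r - (Cf k).G₂ i x μ r‖ ≤ δG k i)
    (hGd₃ : ∀ k i x μ, ‖(Cf (k + 1)).G₃ i x μ - (Cf k).G₃ i x μ‖ ≤ δG k i) (hRd : ∀ k i x μ, ‖(Cf (k + 1)).Rc i x μ - (Cf k).Rc i x μ‖ ≤ δR k i)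
    (hT : ∀ k y j μ (t : Fin (lev L k)), ‖TBal L M (W (k + 1)) k y j μ t - TBal L M (W k) k y j μ t‖ ≤ θ k)
    (hrate : ∀ k,
      sameBnd d L o (Cst d a) ((1 + Fintype.card o * (Real.exp ((((d + 1) * L : ℕ) : ℝ) * α) - 1)) * cR d L o * Γ * Real.exp E)
          (1 + Fintype.card o * (Real.exp ((((d + 1) * L : ℕ) : ℝ) * α) - 1) + (1 + Fintype.card o * (Real.exp ((((d + 1) * L : ℕ) : ℝ) * α) - 1)) * cR d L o * Γ * Real.exp E)
          (σ₁ (k + 1) k) (γ (k + 1) k) (lev L k)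
        + crossBnd o (Cst d a) (1 + Fintype.card o * (Real.exp ((((d + 1) * L : ℕ) : ℝ) * α) - 1) + (1 + Fintype.card o * (Real.exp ((((d + 1) * L : ℕ) : ℝ) * α) - 1)) * cR d L o * Γ * Real.exp E)
          (∑ i ∈ range k, DeltaStep d L o (cW k i) (γ k i) (δG k i) (δR k i)) (∏ i ∈ range k, (1 + epsStep d L o (σ₁ (k + 1) i) (γ (k + 1) i))) (θ k)
        ≤ Cr * ρ ^ k)
    {P₄ : (k : ℕ) → Matrix (idx L M k × o) (idx L M k × o) ℂ} {κ₄ C₄ : ℝ}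
    (hP₄ : PerturbationLaws (fun k => calDalev L M a ha k ⊗ₖ (1 : Matrix o o ℂ)) P₄ (fun k => JpcT L M k ⊗ₖ (1 : Matrix o o ℂ)) κ₄ (fun k => C₄ * ρ ^ k))
    (hsmall : kappaB o d a αR βR C (kappaQ d a (a : ℂ) (Fintype.card o * (Real.exp ((((d + 1) * L : ℕ) : ℝ) * α) - 1)
      + (1 + Fintype.card o * (Real.exp ((((d + 1) * L : ℕ) : ℝ) * α) - 1)) * cR d L o * Γ * Real.exp E)) κ₄ < 1) :
    TowerLimitRate (fun k => Qlev L M k ⊗ₖ (1 : Matrix o o ℂ)) ((L : ℝ) ^ d)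
      (fun k => (calDalev L M a ha k ⊗ₖ (1 : Matrix o o ℂ)
        + tierBPert L M R (avgPertFull L M a (fun k => TBal L M (W k) k) (fun k => Erem L M (W k) (Cf k) k)) P₄ k)⁻¹)
      (Cpert (kappaB o d a αR βR C (kappaQ d a (a : ℂ) (Fintype.card o * (Real.exp ((((d + 1) * L : ℕ) : ℝ) * α) - 1)
          + (1 + Fintype.card o * (Real.exp ((((d + 1) * L : ℕ) : ℝ) * α) - 1)) * cR d L o * Γ * Real.exp E)) κ₄) (2 * d * Cst d a) (CJ d a)
        (C2B o d L a αR βR C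
          (a * C2gram (Cst d a) 1 (Fintype.card o * (Real.exp ((((d + 1) * L : ℕ) : ℝ) * α) - 1)
              + (1 + Fintype.card o * (Real.exp ((((d + 1) * L : ℕ) : ℝ) * α) - 1)) * cR d L o * Γ * Real.exp E) (2 * d * Cst d a) (CJ d a) (Cst d a)
            (Cst d a * Fintype.card o * (thetaZero d L α σ + (Real.exp ((((d + 1) * L : ℕ) : ℝ) * α) - 1)) + Cr)) C₄) 0 1) ρ := by
  set τ : ℝ := Real.exp ((((d + 1) * L : ℕ) : ℝ) * α) - 1 with hτdef
  have hτ0 : 0 ≤ τ := by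
    rw [hτdef]; linarith [Real.add_one_le_exp ((((d + 1) * L : ℕ) : ℝ) * α), (by positivity : (0 : ℝ) ≤ (((d + 1) * L : ℕ) : ℝ) * α)]
  have hco : (0 : ℝ) ≤ Fintype.card o := Nat.cast_nonneg _
  have hcR := cR_nonneg (d := d) L (o := o)
  have hCst := Cst_nonneg d a
  have hΓ0 : 0 ≤ Γ := (Finset.sum_nonneg fun i _ => hγ0 0 i).trans (hΓ 0 1)
  set r : ℝ := (1 + Fintype.card o * τ) * cR d L o * Γ * Real.exp E with hrdef
  have hr : 0 ≤ r := by
    rw [hrdef]; exact mul_nonneg (mul_nonneg (mul_nonneg (by linarith [mul_nonneg hco hτ0]) hcR) hΓ0) (Real.exp_nonneg _)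
  have hF0 : 0 ≤ 1 + Fintype.card o * τ + r := add_nonneg (add_nonneg zero_le_one (mul_nonneg hco hτ0)) hr
  have hτW : ∀ k k' y j μ (t : Fin (lev L k')), ‖TBal L M (W k) k' y j μ t - 1‖ ≤ τ := fun k k' y j μ t =>
    norm_TBal_sub_one_le_exp L M hL hα (W := fun _ => W k) (fun _ i ν b => hWa k i ν b) k' y j μ t
  -- size of the constructed remainder of problem `k` at every level `k'`
  have hsize : ∀ k k', ‖Erem L M (W k) (Cf k) k'‖ ≤ r := fun k k' =>
    opNorm_Erem_le L M (W := W k) (C := Cf k) (σ := σ₁ k) (γ := γ k) hτ0 (hσ₁0 k) (hγ0 k) (hWn k) (hτW k) (hS k) (hG₁ k) (hG₂ k) (hG₃ k) (hRc k) (hΓ k) (hE k) k'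
  have hfull : ∀ k k', ‖sqrtVol d L k' • QfullLev L M (W k) (Cf k) k'‖ ≤ 1 + Fintype.card o * τ + r := by
    intro k k'
    rw [← Bfree_add_EcovT_add_Erem]
    exact (norm_add_le _ _).trans (add_le_add ((norm_add_le _ _).trans (add_le_add (opNorm_Bfree_le L M k') (opNorm_EcovT_le L M hτ0 (hτW k) k'))) (hsize k k'))
  -- same-data bound for problem `k+1` at step `k`
  have hsame : ∀ k, ‖(Erem L M (W (k + 1)) (Cf (k + 1)) (k + 1) * (JpcT L M k ⊗ₖ (1 : Matrix o o ℂ)) - Erem L M (W (k + 1)) (Cf (k + 1)) k)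
      * (calDalev L M a ha k ⊗ₖ (1 : Matrix o o ℂ))⁻¹‖
      ≤ sameBnd d L o (Cst d a) r (1 + Fintype.card o * τ + r) (σ₁ (k + 1) k) (γ (k + 1) k) (lev L k) := by
    intro k
    rw [sameBnd]
    refine (same_data_pair_le L M a ha (hσ₁0 (k + 1) k) (hγ0 (k + 1) k) k (hWn (k + 1) (k + 1)) (hS (k + 1) k) (hG₁ (k + 1) k) (hG₂ (k + 1) k) (hG₃ (k + 1) k)
      (hRc (k + 1) k)).trans ?_
    have h1 := hsize (k + 1) k
    have h2 := hfull (k + 1) k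
    rw [← Bfree_add_EcovT_add_Erem] at h2
    have hA : 0 ≤ d * Cst d a / (lev L k : ℕ) + Fintype.card o * σ₁ (k + 1) k * Cst d a :=
      add_nonneg (div_nonneg (mul_nonneg (Nat.cast_nonneg _) hCst) (Nat.cast_nonneg _)) (mul_nonneg (mul_nonneg hco (hσ₁0 _ _)) hCst)
    exact add_le_add (mul_le_mul_of_nonneg_right h1 hA) (mul_le_mul_of_nonneg_right (mul_le_mul_of_nonneg_right h2 (mul_nonneg hcR (hγ0 _ _))) hCst)
  -- cross bound between the problems `k+1` and `k` at level `k`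
  have hcross : ∀ k, ‖(Erem L M (W (k + 1)) (Cf (k + 1)) k - Erem L M (W k) (Cf k) k) * (calDalev L M a ha k ⊗ₖ (1 : Matrix o o ℂ))⁻¹‖
      ≤ crossBnd o (Cst d a) (1 + Fintype.card o * τ + r) (∑ i ∈ range k, DeltaStep d L o (cW k i) (γ k i) (δG k i) (δR k i))
          (∏ i ∈ range k, (1 + epsStep d L o (σ₁ (k + 1) i) (γ (k + 1) i))) (θ k) := by
    intro k
    rw [crossBnd]
    refine (cross_pair_le L M a ha (W := W k) (W' := W (k + 1)) (C := Cf k) (C' := Cf (k + 1)) (hθ0' k) k (hT k)).trans ?_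
    refine mul_le_mul_of_nonneg_right (add_le_add ?_ le_rfl) hCst
    refine ComposedRemainderLipschitz.opNorm_sqrtVol_smul_QfullLev_sub_le L M (W := W k) (W' := W (k + 1)) (C := Cf k) (C' := Cf (k + 1))
      (F := 1 + Fintype.card o * τ + r) (ε := fun i => epsStep d L o (σ₁ (k + 1) i) (γ (k + 1) i)) (Δ := fun i => DeltaStep d L o (cW k i) (γ k i) (δG k i) (δR k i))
      hF0 (fun i => ?_) (fun i => ?_) (hfull k) (fun i => ?_) (fun i => ?_) k
    · exact add_nonneg (mul_nonneg hco (hσ₁0 (k + 1) i)) (mul_nonneg hcR (hγ0 (k + 1) i))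
    · have hdS : 0 ≤ deltaS d L (cW k i) := by
        unfold deltaS; have := one_le_pow₀ (M₀ := ℝ) (a := 1 + cW k i) (by linarith [hcW0 k i]) (n := (d + 1) * L); linarith
      exact add_nonneg (mul_nonneg hco hdS) (mul_nonneg hcR (add_nonneg (hδG0 k i) (mul_nonneg (hγ0 k i) (add_nonneg (hδR0 k i) (mul_nonneg zero_le_two hdS)))))
    · refine (ComposedRemainderLipschitz.opNorm_QlinStep_le L M (hσ₁0 (k + 1) i) (hγ0 (k + 1) i) i (hWn (k + 1) (i + 1)) (hS (k + 1) i) (hG₁ (k + 1) i) (hG₂ (k + 1) i)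
        (hG₃ (k + 1) i) (hRc (k + 1) i)).trans (le_of_eq ?_)
      rw [epsStep]; ring
    · have h := ComposedRemainderLipschitz.opNorm_QlinStep_sub_le L M (W := W k) (W' := W (k + 1)) (C := Cf k) (C' := Cf (k + 1)) (hγ0 k i) (hcW0 k i) (hδG0 k i) (hδR0 k i) i
        (hWn k (i + 1)) (hWn (k + 1) (i + 1)) (hWd k i) (hG₁ k i) (hG₂ k i) (hG₃ k i) (hRc k i) (hRc (k + 1) i) (hGd₁ k i) (hGd₂ k i) (hGd₃ k i) (hRd k i)
      refine h.trans (le_of_eq ?_)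
      rw [DeltaStep, deltaS]
  have hRem := averagingLaws_Erem L M a ha (fun k => hsize k k) hsame hcross hrate
  exact composed_averaging_remainder_rate L M a ha hL hd hreg hC hNE3 hα hσ hθ0 hθ1 hθρ hρ hρ1 hWn hWa hWc hr hRem hP₄ hsmall

end End

end Summit.QuantumFields.BalabanUV.T4Continuum.NE2.ComposedRemainderTwoLevel

end
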